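import Literature.Combinatorics.Optimization.SeparatingFunctionalPsdRank
import Literature.Combinatorics.Optimization.PsdFactorNorms
import HarnessLib

/-!
# Lee–Raghavendra–Steurer 2015, Theorem 3.3 (psd factorization scaling) DERIVED from Lemma 2.1
# (Briët–Dadush–Pokutta rescaling = FGPRT Cor. 6.8)

`SeparatingFunctionalPsdRank.lean` vendors LRS Thm 3.3 as the named fact
`LeeRaghavendraSteurer2015_thm33`; its printed proof (p. 14–15) is one page of matrix algebra on top
of Lemma 2.1 ("Factorization rescaling", Briët–Dadush–Pokutta: a psd factorisation of size `r` of
`M` with `‖A_i‖·‖B_j‖_* ≤ r²‖M‖_∞`), and Lemma 2.1 is in the tree as the named fact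
`FawziEtAl2015_cor68` (FGPRT Cor. 6.8 = BDP Thm 6, sharp form: factors with largest eigenvalue
`≤ √(r‖M‖_∞)`, file `PsdFactorNorms.lean`).  This file PROVES

* `LeeRaghavendraSteurer2015_thm33_of_cor68 : FawziEtAl2015_cor68 → LeeRaghavendraSteurer2015_thm33`
* `LeeRaghavendraSteurer2015_thm33_holds : LeeRaghavendraSteurer2015_thm33` — the DISCHARGE, now that
  `FawziEtAl2015_cor68_holds` (John's theorem route, `PsdFactorNorms.lean`) is proved.

following the printed proof: normalise the Cor. 6.8 factors to `A_i ⪯ γ·Id` (`γ = r²‖M‖_∞`),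
`Tr B_j ≤ 1` (indeed `B_j ⪯ Id/r`); put `A = η‖M‖_∞ Id + (1/p) Σ_i A_i ≻ 0`, `S = A^{1/2}`
(Mathlib's `CFC.sqrt`), `P_i = S⁻¹ (η‖M‖_∞ Id + A_i) S⁻¹`, `Q_j = S B_j S`; then (2) `Σ_i P_i = p·Id`,
(1) `Tr(P_i Q_j) = M_{ij} + η‖M‖_∞ Tr B_j ∈ [M_{ij}, M_{ij} + η‖M‖_∞]`, (3) `P_i ⪯ (η‖M‖_∞ + γ) A⁻¹
⪯ (1 + r²/η) Id ⪯ (2r²/η) Id` ("since `r ≥ 1` and `η ≤ 1`"), and (4) `Q_j ⪯ S (Id/r) S = A/r ⪯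
‖M‖_∞(η + r²) Id = r‖M‖_∞(η + r²)·𝕀` (the print bounds `‖Q_j‖_* ≤ ‖A‖‖B_j‖_* ≤ γ + η‖M‖_∞` and
uses `Q ⪯ ‖Q‖_* Id`; our Loewner route gives the same constant).  The degenerate case `r = 0`
(`M = 0`) is dispatched with `0 × 0` matrices.  With `FawziEtAl2015_cor68_holds`
(proved in `PsdFactorNorms.lean` from John's theorem in KKT form) this gives the unconditional
`LeeRaghavendraSteurer2015_thm33_holds`.

Sources: LRS [LeeRaghavendraSteurer2015] held text `paper:arxiv-1411.6317`, Lemma 2.1 (p. 11),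
Thm 3.3 and its proof (p. 14–15); FGPRT [FawziEtAl2015] Cor. 6.8 (p. 19).  No definitions, no facts.
-/

noncomputable section

open Finset Matrix
open scoped MatrixOrder

namespace Literature.Combinatorics.Optimization

namespace Thm33

variable {k : ℕ}

/-- Conjugation by a symmetric matrix is monotone for the Loewner order. [cite: LeeRaghavendraSteurer2015, Thm 3.3 proof (p. 14–15)] -/
theorem conj_mono {X Y : Matrix (Fin k) (Fin k) ℝ} (h : X ≤ Y) {C : Matrix (Fin k) (Fin k) ℝ}
    (hC : C.IsHermitian) : C * X * C ≤ C * Y * C := by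
  exact IsSelfAdjoint.conjugate_le_conjugate h hC

/-- Nonnegative scalars preserve the Loewner order. [cite: LeeRaghavendraSteurer2015, Thm 3.3 proof (p. 14–15)] -/
theorem smul_mono {X Y : Matrix (Fin k) (Fin k) ℝ} (h : X ≤ Y) {c : ℝ} (hc : 0 ≤ c) :
    c • X ≤ c • Y := by
  rw [Matrix.le_iff] at h ⊢
  rw [← smul_sub]
  exact h.smul hc

/-- `c·Id ⪯ c'·Id` for `c ≤ c'`. [cite: LeeRaghavendraSteurer2015, Thm 3.3 proof (p. 14–15)] -/
theorem smul_one_le_smul_one {c c' : ℝ} (h : c ≤ c') :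
    c • (1 : Matrix (Fin k) (Fin k) ℝ) ≤ c' • (1 : Matrix (Fin k) (Fin k) ℝ) := by
  rw [Matrix.le_iff, ← sub_smul]
  exact PosSemidef.one.smul (sub_nonneg.2 h)

/-- The trace is monotone for the Loewner order. [cite: LeeRaghavendraSteurer2015, §2.1 (p. 10: Loewner ordering)] -/
theorem trace_mono {X Y : Matrix (Fin k) (Fin k) ℝ} (h : X ≤ Y) : X.trace ≤ Y.trace := by
  rw [Matrix.le_iff] at h
  have := h.trace_nonneg
  rw [trace_sub] at this
  linarith

/-- Every `0 × 0` real matrix is psd (plumbing for the degenerate case `r = 0`). [folklore] -/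
private theorem posSemidef_fin_zero (X : Matrix (Fin 0) (Fin 0) ℝ) : X.PosSemidef := by
  refine ⟨?_, fun x => ?_⟩
  · ext i; exact Fin.elim0 i
  · have hx : x = 0 := Subsingleton.elim _ _
    subst hx
    simp

/-- Every Loewner inequality between `0 × 0` real matrices holds. [folklore] -/
private theorem le_fin_zero (X Y : Matrix (Fin 0) (Fin 0) ℝ) : X ≤ Y := by
  rw [Matrix.le_iff]
  exact posSemidef_fin_zero _

end Thm33

open Thm33 in
/-- **Lee–Raghavendra–Steurer 2015, Theorem 3.3 DERIVED from Lemma 2.1** (= FGPRT Cor. 6.8 / BDP Thm 6,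
the named fact `FawziEtAl2015_cor68`), following the printed proof (p. 14–15): with the Cor. 6.8
factors normalised to `A_i ⪯ r²‖M‖_∞ Id`, `B_j ⪯ Id/r` (so `Tr B_j ≤ 1`), and
`A = η‖M‖_∞ Id + (1/p)Σ A_i`, `S = A^{1/2}`, the matrices `P_i = S⁻¹(η‖M‖_∞ Id + A_i)S⁻¹`,
`Q_j = S B_j S` satisfy (1)–(4). [cite: LeeRaghavendraSteurer2015, Thm. 3.3 and its proof (p. 14–15); Lemma 2.1 (p. 11)] -/
theorem LeeRaghavendraSteurer2015_thm33_of_cor68 (h68 : FawziEtAl2015_cor68) :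
    LeeRaghavendraSteurer2015_thm33 := by
  intro ι κ _ _ _ M Δ hM η hη hη1 r hr hmin
  classical
  rcases Nat.eq_zero_or_pos r with rfl | hr1
  · -- `r = 0`: `M = 0`, and `0 × 0` matrices do the job
    have hM0 : ∀ i j, M i j = 0 := hasPsdFactorization_zero_iff.1 hr
    refine ⟨0, fun _ => 1, fun _ => 1, fun _ => posSemidef_fin_zero _, fun _ => posSemidef_fin_zero _,
      fun i j => ?_, ?_, fun _ => le_fin_zero _ _, fun _ => le_fin_zero _ _⟩
    · have hΔ : 0 ≤ Δ := (hM i j).1.trans (hM i j).2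
      have htr : ((1 : Matrix (Fin 0) (Fin 0) ℝ) * 1).trace = 0 := by simp [Matrix.trace]
      rw [htr, hM0 i j]
      exact ⟨le_rfl, by positivity⟩
    · ext i j; exact Fin.elim0 i
  · -- `r ≥ 1`: then `M ≠ 0`, so `Δ > 0`
    have hΔ0 : 0 < Δ := by
      by_contra hΔ
      push Not at hΔ
      have hM0 : ∀ i j, M i j = 0 := fun i j => le_antisymm ((hM i j).2.trans hΔ) (hM i j).1
      have := hmin 0 (hasPsdFactorization_zero_iff.2 hM0)
      omega
    have hr0 : (0 : ℝ) < r := by exact_mod_cast hr1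
    have hr1' : (1 : ℝ) ≤ r := by exact_mod_cast hr1
    -- Lemma 2.1 (sharp Briët–Dadush–Pokutta via FGPRT Cor. 6.8)
    obtain ⟨A, B, hA, hB, hMAB, hAle, hBle⟩ := h68 ι κ M r Δ (fun i j => (hM i j).2) hr
    set ρ : ℝ := Real.sqrt (r * Δ) with hρ
    have hρ0 : 0 < ρ := Real.sqrt_pos.2 (by positivity)
    have hρsq : ρ * ρ = r * Δ := Real.mul_self_sqrt (by positivity)
    set s : ℝ := r * ρ with hs
    have hs0 : 0 < s := by positivity
    set γ : ℝ := (r : ℝ) ^ 2 * Δ with hγ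
    have hγ0 : 0 ≤ γ := by positivity
    have hAle' : ∀ i, A i ≤ ρ • (1 : Matrix (Fin r) (Fin r) ℝ) := fun i => by
      rw [Matrix.le_iff]; exact hAle i
    have hBle' : ∀ j, B j ≤ ρ • (1 : Matrix (Fin r) (Fin r) ℝ) := fun j => by
      rw [Matrix.le_iff]; exact hBle j
    -- normalised factors: `A' i ⪯ γ Id`, `B' j ⪯ Id/r`, `M = Tr(A' B')`
    obtain ⟨A', hA'⟩ : ∃ A' : ι → Matrix (Fin r) (Fin r) ℝ, A' = fun i => s • A i := ⟨_, rfl⟩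
    obtain ⟨B', hB'⟩ : ∃ B' : κ → Matrix (Fin r) (Fin r) ℝ, B' = fun j => s⁻¹ • B j := ⟨_, rfl⟩
    have hA'psd : ∀ i, (A' i).PosSemidef := fun i => by rw [hA']; exact (hA i).smul hs0.le
    have hB'psd : ∀ j, (B' j).PosSemidef := fun j => by
      rw [hB']; exact (hB j).smul (inv_nonneg.2 hs0.le)
    have hMAB' : ∀ i j, M i j = (A' i * B' j).trace := by
      intro i j
      rw [hMAB i j, hA', hB']
      show (A i * B j).trace = (s • A i * (s⁻¹ • B j)).trace
      rw [Matrix.smul_mul, Matrix.mul_smul, smul_smul, mul_inv_cancel₀ hs0.ne', one_smul]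
    have hA'le : ∀ i, A' i ≤ γ • (1 : Matrix (Fin r) (Fin r) ℝ) := by
      intro i
      have h1 := smul_mono (hAle' i) hs0.le
      have h2 : s * ρ = γ := by rw [hs, hγ, mul_assoc, hρsq]; ring
      rw [smul_smul, h2] at h1
      rw [hA']
      exact h1
    have hB'le : ∀ j, B' j ≤ (r : ℝ)⁻¹ • (1 : Matrix (Fin r) (Fin r) ℝ) := by
      intro j
      have h1 := smul_mono (hBle' j) (inv_nonneg.2 hs0.le)
      have h2 : s⁻¹ * ρ = (r : ℝ)⁻¹ := by rw [hs]; field_simp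
      rw [smul_smul, h2] at h1
      rw [hB']
      exact h1
    have htr1 : ((r : ℝ)⁻¹ • (1 : Matrix (Fin r) (Fin r) ℝ)).trace = 1 := by
      rw [trace_smul, trace_one, Fintype.card_fin, smul_eq_mul, inv_mul_cancel₀ hr0.ne']
    have hB'tr : ∀ j, (B' j).trace ≤ 1 := fun j => htr1 ▸ trace_mono (hB'le j)
    have hB'tr0 : ∀ j, 0 ≤ (B' j).trace := fun j => (hB'psd j).trace_nonneg
    -- `A₀ = ηΔ Id + (1/p) Σ A' i`
    set p : ℝ := (Fintype.card ι : ℝ) with hp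
    have hp0 : 0 < p := by rw [hp]; exact_mod_cast Fintype.card_pos
    obtain ⟨A₀, hA₀⟩ : ∃ A₀ : Matrix (Fin r) (Fin r) ℝ, A₀ = (η * Δ) • 1 + p⁻¹ • ∑ i, A' i :=
      ⟨_, rfl⟩
    have hsum_psd : (p⁻¹ • ∑ i, A' i).PosSemidef :=
      (posSemidef_sum Finset.univ fun i _ => hA'psd i).smul (inv_nonneg.2 hp0.le)
    have hηΔ : 0 < η * Δ := mul_pos hη hΔ0
    have hA₀pd : A₀.PosDef := by
      have h1 : ((η * Δ) • (1 : Matrix (Fin r) (Fin r) ℝ)).PosDef := by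
        rw [smul_one_eq_diagonal]
        exact posDef_diagonal_iff.2 fun _ => hηΔ
      rw [hA₀]
      exact h1.add_posSemidef hsum_psd
    have hA₀lo : (η * Δ) • (1 : Matrix (Fin r) (Fin r) ℝ) ≤ A₀ := by
      rw [Matrix.le_iff, hA₀, add_sub_cancel_left]
      exact hsum_psd
    have hA₀hi : A₀ ≤ (η * Δ + γ) • (1 : Matrix (Fin r) (Fin r) ℝ) := by
      -- the average of the `A' i` is `⪯ γ Id`
      have havg : p⁻¹ • ∑ i, A' i ≤ γ • (1 : Matrix (Fin r) (Fin r) ℝ) := by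
        have h1 : ∑ i, A' i ≤ ∑ _i : ι, γ • (1 : Matrix (Fin r) (Fin r) ℝ) :=
          Finset.sum_le_sum fun i _ => hA'le i
        have hc : ∑ _i : ι, γ • (1 : Matrix (Fin r) (Fin r) ℝ) =
            (p * γ) • (1 : Matrix (Fin r) (Fin r) ℝ) := by
          rw [Finset.sum_const, Finset.card_univ, ← Nat.cast_smul_eq_nsmul ℝ, smul_smul, ← hp]
        rw [hc] at h1
        have h2 := smul_mono h1 (inv_nonneg.2 hp0.le)
        rwa [smul_smul, ← mul_assoc, inv_mul_cancel₀ hp0.ne', one_mul] at h2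
      rw [hA₀, add_smul]
      exact add_le_add le_rfl havg
    -- `S = A₀^{1/2}`, invertible and symmetric
    obtain ⟨S, hSdef⟩ : ∃ S : Matrix (Fin r) (Fin r) ℝ, S = CFC.sqrt A₀ := ⟨_, rfl⟩
    have hS0 : 0 ≤ S := by rw [hSdef]; exact CFC.sqrt_nonneg A₀
    have hSherm : S.IsHermitian := hS0.posSemidef.1
    have hSS : S * S = A₀ := by
      rw [hSdef]; exact CFC.sqrt_mul_sqrt_self A₀ hA₀pd.posSemidef.nonneg
    have hSdet : IsUnit S.det := by
      have hdetA : A₀.det ≠ 0 := hA₀pd.det_pos.ne'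
      rw [← hSS, det_mul] at hdetA
      exact isUnit_iff_ne_zero.2 fun h => hdetA (by rw [h, mul_zero])
    have hSinvS : S⁻¹ * S = 1 := nonsing_inv_mul S hSdet
    have hSSinv : S * S⁻¹ = 1 := mul_nonsing_inv S hSdet
    have hSinv_herm : S⁻¹.IsHermitian := hSherm.inv
    -- `A₀⁻¹ = S⁻¹ S⁻¹ ⪯ (ηΔ)⁻¹ Id`
    have hA₀inv : S⁻¹ * S⁻¹ ≤ (η * Δ)⁻¹ • (1 : Matrix (Fin r) (Fin r) ℝ) := by
      have h1 := conj_mono hA₀lo hSinv_herm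
      rw [Matrix.mul_smul, Matrix.mul_one, Matrix.smul_mul, ← hSS, ← Matrix.mul_assoc, hSinvS,
        Matrix.one_mul, hSSinv] at h1
      have h2 := smul_mono h1 (inv_nonneg.2 hηΔ.le)
      rwa [smul_smul, inv_mul_cancel₀ hηΔ.ne', one_smul] at h2
    -- the matrices `X i = ηΔ Id + A' i`
    obtain ⟨X, hX⟩ : ∃ X : ι → Matrix (Fin r) (Fin r) ℝ, X = fun i => (η * Δ) • 1 + A' i :=
      ⟨_, rfl⟩
    have hXpsd : ∀ i, (X i).PosSemidef := fun i => by
      rw [hX]; exact (PosSemidef.one.smul hηΔ.le).add (hA'psd i)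
    have hXle : ∀ i, X i ≤ (η * Δ + γ) • (1 : Matrix (Fin r) (Fin r) ℝ) := by
      intro i
      rw [hX]
      show (η * Δ) • 1 + A' i ≤ _
      rw [add_smul]
      exact add_le_add le_rfl (hA'le i)
    refine ⟨r, fun i => S⁻¹ * X i * S⁻¹, fun j => S * B' j * S, ?_, ?_, ?_, ?_, ?_, ?_⟩
    · -- `P_i ⪰ 0`
      intro i
      show (S⁻¹ * X i * S⁻¹).PosSemidef
      have := (hXpsd i).mul_mul_conjTranspose_same S⁻¹
      rwa [hSinv_herm.eq] at this
    · -- `Q_j ⪰ 0`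
      intro j
      show (S * B' j * S).PosSemidef
      have := (hB'psd j).mul_mul_conjTranspose_same S
      rwa [hSherm.eq] at this
    · -- (1) `Tr(P_i Q_j) = M_ij + ηΔ Tr B'_j ∈ [M_ij, M_ij + ηΔ]`
      intro i j
      have key : (S⁻¹ * X i * S⁻¹ * (S * B' j * S)).trace = M i j + η * Δ * (B' j).trace := by
        calc (S⁻¹ * X i * S⁻¹ * (S * B' j * S)).trace
            = (S⁻¹ * X i * (S⁻¹ * S) * B' j * S).trace := by simp only [Matrix.mul_assoc]
          _ = (S⁻¹ * (X i * B' j) * S).trace := by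
              rw [hSinvS, Matrix.mul_one]; simp only [Matrix.mul_assoc]
          _ = (S * S⁻¹ * (X i * B' j)).trace := by rw [Matrix.trace_mul_cycle]
          _ = (X i * B' j).trace := by rw [hSSinv, Matrix.one_mul]
          _ = M i j + η * Δ * (B' j).trace := by
              rw [hX]
              show (((η * Δ) • 1 + A' i) * B' j).trace = _
              rw [add_mul, trace_add, Matrix.smul_mul, Matrix.one_mul, trace_smul, smul_eq_mul,
                ← hMAB' i j]
              ring
      show M i j ≤ (S⁻¹ * X i * S⁻¹ * (S * B' j * S)).trace ∧
        (S⁻¹ * X i * S⁻¹ * (S * B' j * S)).trace ≤ M i j + η * Δ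
      rw [key]
      constructor
      · nlinarith [hB'tr0 j, hηΔ]
      · nlinarith [hB'tr j, hηΔ]
    · -- (2) `Σ_i P_i = p Id`
      have hsumX : ∑ i, X i = p • A₀ := by
        rw [hX]
        show ∑ i, ((η * Δ) • 1 + A' i) = p • A₀
        rw [Finset.sum_add_distrib, Finset.sum_const, Finset.card_univ, ← Nat.cast_smul_eq_nsmul ℝ,
          ← hp, hA₀, smul_add, smul_smul, smul_smul, mul_inv_cancel₀ hp0.ne', one_smul]
      show ∑ i, S⁻¹ * X i * S⁻¹ = (Fintype.card ι : ℝ) • 1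
      calc ∑ i, S⁻¹ * X i * S⁻¹ = S⁻¹ * (∑ i, X i) * S⁻¹ := by
            rw [Finset.mul_sum, Finset.sum_mul]
        _ = p • (S⁻¹ * A₀ * S⁻¹) := by rw [hsumX, Matrix.mul_smul, Matrix.smul_mul]
        _ = p • 1 := by
            rw [← hSS, ← Matrix.mul_assoc, hSinvS, Matrix.one_mul, hSSinv]
        _ = (Fintype.card ι : ℝ) • 1 := by rw [hp]
    · -- (3) `P_i ⪯ (ηΔ + γ) A₀⁻¹ ⪯ (1 + r²/η) Id ⪯ (2r²/η) Id`
      intro i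
      show S⁻¹ * X i * S⁻¹ ≤ _
      have h1 : S⁻¹ * X i * S⁻¹ ≤ S⁻¹ * ((η * Δ + γ) • (1 : Matrix (Fin r) (Fin r) ℝ)) * S⁻¹ :=
        conj_mono (hXle i) hSinv_herm
      rw [Matrix.mul_smul, Matrix.mul_one, Matrix.smul_mul] at h1
      have h2 : (η * Δ + γ) • (S⁻¹ * S⁻¹) ≤
          (η * Δ + γ) • ((η * Δ)⁻¹ • (1 : Matrix (Fin r) (Fin r) ℝ)) :=
        smul_mono hA₀inv (by positivity)
      rw [smul_smul] at h2
      refine h1.trans (h2.trans (smul_one_le_smul_one ?_))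
      rw [hγ]
      have key : (η * Δ + (r : ℝ) ^ 2 * Δ) * (η * Δ)⁻¹ = 1 + (r : ℝ) ^ 2 / η := by
        field_simp
      rw [key]
      have h3 : (1 : ℝ) ≤ (r : ℝ) ^ 2 / η := by
        rw [le_div_iff₀ hη]; nlinarith
      have h4 : 2 * (r : ℝ) ^ 2 / η = 2 * ((r : ℝ) ^ 2 / η) := by ring
      rw [h4]
      linarith
    · -- (4) `Q_j ⪯ A₀/r ⪯ Δ(η + r²) Id = rΔ(η + r²) 𝕀`
      intro j
      show S * B' j * S ≤ _
      have h1 : S * B' j * S ≤ S * ((r : ℝ)⁻¹ • (1 : Matrix (Fin r) (Fin r) ℝ)) * S :=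
        conj_mono (hB'le j) hSherm
      rw [Matrix.mul_smul, Matrix.mul_one, Matrix.smul_mul, hSS] at h1
      have h2 : (r : ℝ)⁻¹ • A₀ ≤ (r : ℝ)⁻¹ • ((η * Δ + γ) • (1 : Matrix (Fin r) (Fin r) ℝ)) :=
        smul_mono hA₀hi (inv_nonneg.2 hr0.le)
      rw [smul_smul] at h2
      refine h1.trans (h2.trans ?_)
      unfold uniformDensity
      rw [smul_smul]
      refine smul_one_le_smul_one ?_
      rw [hγ]
      have h3 : (r : ℝ)⁻¹ * (η * Δ + (r : ℝ) ^ 2 * Δ) ≤ Δ * (η + (r : ℝ) ^ 2) := by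
        rw [inv_mul_le_iff₀ hr0]
        nlinarith [mul_nonneg hΔ0.le hη.le]
      calc (r : ℝ)⁻¹ * (η * Δ + (r : ℝ) ^ 2 * Δ) ≤ Δ * (η + (r : ℝ) ^ 2) := h3
        _ = Δ * (η + (r : ℝ) ^ 2) * r * (1 / (r : ℝ)) := by field_simp

/-- **Lee–Raghavendra–Steurer 2015, Theorem 3.3 — DISCHARGED** (`LeeRaghavendraSteurer2015_thm33_holds :
LeeRaghavendraSteurer2015_thm33`): the reduction `LeeRaghavendraSteurer2015_thm33_of_cor68` fed with the
proved sharp rescaling `FawziEtAl2015_cor68_holds` (FGPRT Cor. 6.8 = Briët–Dadush–Pokutta Lemma 2.1).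
[cite: LeeRaghavendraSteurer2015, Thm. 3.3 (p. 14–15); FawziEtAl2015, Cor. 6.8 (p19)] -/
theorem LeeRaghavendraSteurer2015_thm33_holds : LeeRaghavendraSteurer2015_thm33 :=
  LeeRaghavendraSteurer2015_thm33_of_cor68 FawziEtAl2015_cor68_holds

end Literature.Combinatorics.Optimization

end
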